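import Literature.MathematicalPhysics.QuantumFieldTheory.Balaban1983to89.T4ApexTwoLevel
import Literature.MathematicalPhysics.QuantumFieldTheory.Balaban1983to89.T4EMLTangentInjective
import Literature.MathematicalPhysics.QuantumFieldTheory.Balaban1983to89.BlockAveragingFederbush

/-!
# The exp-mean-log fibre law on `SU(N)` from the TANGENT INJECTIVITY of the fibre map: the interface for general `N`

`BlockAveragingEMLHaarACSUN` isolated the ONE analytic statement on which the measure-theoretic residual `HaarAC` of
`T4FiniteEpsInhabited` rests for Bałaban's block averagings (0.4) and (0.11)–(0.12) of [Balaban1987RG1] pp. 253–254 driven by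
the PRINTED small-loop average `ExpMeanLog.expMeanLogSU` on `SU(N)`: the fibre law `EMLFibreLaw (Fin N)` (absolute continuity
of the guarded one-variable laws `W ↦ exp(Σ_i c_i log(h_i W*)) · W`), in the tree at `N = 2` only (`emlFibreLaw_fin_two`).
`T4HaarSUNLocalDiffeo` (Lemma A on `SU(N)`, every `N ≥ 1`) proved the MAP-INDEPENDENT half for general `N`: the push-forward of
Haar measure restricted to an open `S ⊆ SU(N)` under a measurable `K` is absolutely continuous as soon as an ambient representative
`Kmat` of `K` has, at every point of `S`, a strict real Fréchet derivative injective on the tangent space `W · 𝔰𝔲(N)`.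

This module CLOSES THE BOOKKEEPING between the two: it names the remaining MAP-DEPENDENT input as one `Prop`,
`EMLTangentLaw N` (§1) — at every guarded point `W ∈ SU(N)` (`‖h_i W* − 1‖ < 1/2`, weights `c_i ≥ 0` of total `< 1`) the ambient
exp-mean-log map `M ↦ exp(Σ_i c_i mlog(h_i M*)) · M` has SOME strict real derivative `D` at `↑W` with
`∀ X, Xᴴ = −X → tr X = 0 → D (W X) = 0 → X = 0` — and proves `EMLTangentLaw N → EMLFibreLaw (Fin N)` for every `N ≥ 1`
(§2, `emlFibreLaw_of_tangentLaw`: choose the derivative on `S` and apply Lemma A; the consumer-side Haar measure `HaarData.haar`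
is `haarProbability` definitionally), whence both printed-average residuals `BlockHaarAC` / `BlockHaarAC₂` of `T4ApexTwoLevel`
and the conditional inhabitation corollaries follow from `EMLTangentLaw N` alone (§3).  The trace-zero clause is INCLUDED in
the injectivity hypothesis (the weakest form the assembly consumes), so an all-skew tangent-injectivity statement on `U(N)`
implies it by restriction to `SU(N) ⊆ U(N)`.

(v1.1, §4) **STATUS: `EMLTangentLaw N` HOLDS FOR EVERY `N ≥ 1`.**  `T4EMLTangentInjective` (imported from v1.1 on; it imports
`T4HaarSUNLocalDiffeo`) computes the explicit strict derivative `emlD` of the ambient exp-mean-log map at every point of the guard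
`‖h_i W* − 1‖ < 1` and proves that, for unitary `h_i`, `W` in the guard `< 1/2` and weights `c_i ≥ 0` of total `< 1`, `emlD` kills no
non-zero skew tangent vector `W X` (`T4EMLTangentInjective.hasStrictFDerivAt_Kmat`, `T4EMLTangentInjective.emlD_tangent_injective`; the
`β·cot β`-convexity of the differential of `log ∘ exp` on skew matrices); its `emlTangentLaw_specialUnitary` has LITERALLY the binder
list and body of `EMLTangentLaw N`, so `emlTangentLaw_fin : EMLTangentLaw N` is a one-line term (§4).  Consequently the fibre law
`EMLFibreLaw (Fin N)` (`emlFibreLaw_fin`), the per-torus `HaarAC` statements for (0.4) and (0.11)–(0.12) with the printed (outer)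
average, BOTH printed-average residuals `BlockHaarAC F expMeanLogSU` / `BlockHaarAC₂ F 𝓜 expMeanLogSU` of `T4ApexTwoLevel` (there
recorded as «open in that file for `N ≥ 3`, status recorded here») and the inhabitation / reflection-positivity / covariance
corollaries hold UNCONDITIONALLY on `SU(N)` for every `N ≥ 1` and every measurable inner average `𝓜` (§4, suffix `_SUN`; at `N = 2`
they agree with the quaternionic `…_SU2` theorems of `T4ApexTwoLevel` §5d–§5e, which stay).
(v1.2) With FEDERBUSH's implicit inner mean (0.10) — `FederbushMean.federbushSU : GroupAverage SU(N)` of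
`BlockAveragingFederbush` (δ_N = min(1/100, 1/(3N)); (0.5), (0.6) two-sided, (0.7) proved there; `M` measurable at every arity,
`federbushSU_measurable`) — the hypotheses `𝓜`, `hM` of the §4 two-level theorems are DISCHARGED BY NAME: §5 records the
printed two-level operation «inner (0.10)-mean, outer exp-mean-log (0.4)/(0.12)» on `SU(N)`, every `N ≥ 1`, as
`blockHaarAC₂_federbushSU_expMeanLogSU F : BlockHaarAC₂ F federbushSU expMeanLogSU` with its per-torus `HaarAC`, inhabitation and
reflection-positivity / covariance corollaries (one-line instances of §4; nothing printed is asserted here — (0.10) is cited by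
`BlockAveragingFederbush`).

## What this is NOT

Nothing here is an estimate of the papers or progress on the continuum limit: the general-`N` exp-mean-log node is OFF the spine of
the cell's T4 DAG — what is discharged is the measure-theoretic residual `HaarAC` (absolute continuity of the block-averaging fibre
laws driven by the printed small-loop average), i.e. that the CARRIER TYPE of (0.4)- and (0.12)-data on `SU(N)` is inhabited by the
labelled placeholder of `T4FiniteEpsInhabited`, at which the pinned end statement (B) is FALSE (inhabitation of the TYPE, not of
Bałaban's densities; `not_endStatementBPrinted_blockAvgEML_stub_SUN`).  Every declaration is elementary ([folklore]) and nothing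
printed is asserted (the operations (0.4), (0.11)–(0.12) are cited by `BlockAveraging` / `BlockAveragingTwoLevel`; no new citation).
(v1 wording of this paragraph said «`EMLTangentLaw N` is NOT proved here for any `N`»; superseded by §4.)

## Versions

* v1: §1–§3 (the contract `EMLTangentLaw N`, the glue `EMLTangentLaw N → EMLFibreLaw (Fin N)`, the conditional consumers).
* v1.1: import `T4HaarSUNLocalDiffeo` ↦ `T4EMLTangentInjective` (which imports it); §4 — `emlTangentLaw_fin`, `emlFibreLaw_fin` and
  the unconditional `_SUN` consumers for every `N ≥ 1`; header status paragraph.  §1–§3 unchanged (append-only).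
* v1.2: + import `BlockAveragingFederbush`; §5 — the §4 two-level theorems instantiated at Federbush's inner mean `federbushSU`,
  every `N ≥ 1`; header (v1.2) sentence.  §1–§4 unchanged (append-only).
-/

noncomputable section

open MeasureTheory Function NormedSpace

namespace Literature.MathematicalPhysics.QuantumFieldTheory.Balaban1983to89

namespace BlockAveragingEMLFibreLawSUN

open T4Continuum AveragingRT BlockAveraging BlockAveragingTwoLevel
open ExpMeanLog MatrixLog BlockAveragingEMLHaarACSUN T4ApexTwoLevel
open scoped Matrix Matrix.Norms.L2Operator

variable {N : ℕ}

/-! ## 1. The contract for the map-dependent half: tangent injectivity of the exp-mean-log fibre map -/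

/-- **THE EXP-MEAN-LOG TANGENT LAW ON `SU(N)`** (a statement SHAPE, the map-dependent input of the general-`N` fibre law):
for every finite index type `ι`, family `h : ι → SU(N)`, weights `c_i ≥ 0` of total `< 1` and every `W ∈ SU(N)` in the guard
`‖h_i W* − 1‖ < 1/2` (all `i`), the ambient map `M ↦ exp(Σ_i c_i mlog(h_i M*)) · M` on `M_N(ℂ)` has a strict real Fréchet
derivative `D` at `↑W` which is injective on the tangent space `W · 𝔰𝔲(N)`:
`∀ X, Xᴴ = −X → tr X = 0 → D (W X) = 0 → X = 0`. [folklore] -/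
def EMLTangentLaw (N : ℕ) : Prop :=
  ∀ {ι : Type} [Fintype ι] (h : ι → Matrix.specialUnitaryGroup (Fin N) ℂ) (c : ι → ℝ), (∀ i, 0 ≤ c i) → ∑ i, c i < 1 →
    ∀ W : Matrix.specialUnitaryGroup (Fin N) ℂ,
      (∀ i, ‖(h i : Matrix (Fin N) (Fin N) ℂ) * star (W : Matrix (Fin N) (Fin N) ℂ) - 1‖ < 1 / 2) →
      ∃ D : Matrix (Fin N) (Fin N) ℂ →L[ℝ] Matrix (Fin N) (Fin N) ℂ,
        HasStrictFDerivAt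
            (fun M : Matrix (Fin N) (Fin N) ℂ =>
              NormedSpace.exp (∑ i, (c i : ℂ) • MatrixLog.mlog ((h i : Matrix (Fin N) (Fin N) ℂ) * star M)) * M)
            D (W : Matrix (Fin N) (Fin N) ℂ) ∧
          ∀ X : Matrix (Fin N) (Fin N) ℂ, Xᴴ = -X → X.trace = 0 →
            D ((W : Matrix (Fin N) (Fin N) ℂ) * X) = 0 → X = 0

/-! ## 2. The glue: tangent law ⟹ fibre law, every `N ≥ 1` -/

/-- **`EMLTangentLaw N → EMLFibreLaw (Fin N)`** (every `N ≥ 1`): given the tangent law, every guarded exp-mean-log law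
`((Haar)|_S).map K` on `SU(N)` is absolutely continuous — Lemma A on `SU(N)`
(`T4HaarSUNLocalDiffeo.haar_restrict_map_absolutelyContinuous_specialUnitary`) applied to the ambient map
`M ↦ exp(Σ_i c_i mlog(h_i M*)) · M`, which agrees with `K` on `S` by hypothesis, with the derivative CHOSEN pointwise on `S`
from the tangent law (off `S` it is irrelevant and set to `0`). [folklore] -/
theorem emlFibreLaw_of_tangentLaw [NeZero N] (hT : EMLTangentLaw N) : EMLFibreLaw (Fin N) := by
  intro ι _ S hS h c hc hs K hK hg hKW
  classical
  have hex : ∀ W ∈ S, ∃ D : Matrix (Fin N) (Fin N) ℂ →L[ℝ] Matrix (Fin N) (Fin N) ℂ,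
      HasStrictFDerivAt
          (fun M : Matrix (Fin N) (Fin N) ℂ =>
            NormedSpace.exp (∑ i, (c i : ℂ) • MatrixLog.mlog ((h i : Matrix (Fin N) (Fin N) ℂ) * star M)) * M)
          D (W : Matrix (Fin N) (Fin N) ℂ) ∧
        ∀ X : Matrix (Fin N) (Fin N) ℂ, Xᴴ = -X → X.trace = 0 →
          D ((W : Matrix (Fin N) (Fin N) ℂ) * X) = 0 → X = 0 :=
    fun W hW => hT h c hc hs W (hg W hW)
  let D : Matrix.specialUnitaryGroup (Fin N) ℂ → Matrix (Fin N) (Fin N) ℂ →L[ℝ] Matrix (Fin N) (Fin N) ℂ :=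
    fun W => if hW : W ∈ S then (hex W hW).choose else 0
  have hD : ∀ W (hW : W ∈ S), D W = (hex W hW).choose := fun W hW => dif_pos hW
  exact T4HaarSUNLocalDiffeo.haar_restrict_map_absolutelyContinuous_specialUnitary hS hK (D := D)
    (fun W hW => by rw [hD W hW]; exact (hex W hW).choose_spec.1)
    (fun W hW => (hKW W hW).symm)
    (fun W hW X hX htr h0 => (hex W hW).choose_spec.2 X hX htr (by rwa [hD W hW] at h0))

/-- At `N = 2` the CONCLUSION of the glue is the tree's quaternionic theorem (`emlFibreLaw_fin_two`), whatever the status of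
the tangent law there; recorded as an `example` (no new content). [folklore] -/
example : EMLFibreLaw (Fin 2) := emlFibreLaw_fin_two

/-! ## 3. Consumers: both printed-average residuals and the conditional inhabitations from the tangent law alone -/

section Consumers

variable (F : T4Family) [NeZero N]

/-- **THE TANGENT LAW GIVES THE ONE-LEVEL RESIDUAL, EVERY `N ≥ 1`**: Bałaban's block averaging (0.4) driven by the printed
small-loop average on `SU(N)` satisfies `HaarAC` on every torus of the family at every level, given `EMLTangentLaw N`
(`T4ApexTwoLevel.blockHaarAC_expMeanLogSU_of_fibreLaw` ∘ `emlFibreLaw_of_tangentLaw`). [folklore] -/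
theorem blockHaarAC_expMeanLogSU_of_tangentLaw (hT : EMLTangentLaw N) :
    BlockHaarAC F (expMeanLogSU : LoopAverage (Matrix.specialUnitaryGroup (Fin N) ℂ)) :=
  blockHaarAC_expMeanLogSU_of_fibreLaw F (emlFibreLaw_of_tangentLaw hT)

/-- **THE TANGENT LAW GIVES THE TWO-LEVEL RESIDUAL FOR EVERY MEASURABLE INNER AVERAGE `𝓜`, EVERY `N ≥ 1`**
(`T4ApexTwoLevel.blockHaarAC₂_expMeanLogSU_of_fibreLaw` ∘ `emlFibreLaw_of_tangentLaw`). [folklore] -/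
theorem blockHaarAC₂_expMeanLogSU_of_tangentLaw (𝓜 : GroupAverage (Matrix.specialUnitaryGroup (Fin N) ℂ))
    (hM : 𝓜.MeasurableM) (hT : EMLTangentLaw N) :
    BlockHaarAC₂ F 𝓜 (expMeanLogSU : LoopAverage (Matrix.specialUnitaryGroup (Fin N) ℂ)) :=
  blockHaarAC₂_expMeanLogSU_of_fibreLaw F 𝓜 hM (emlFibreLaw_of_tangentLaw hT)

/-- Hence, GIVEN the tangent law, (0.4)-data driven by the printed average EXIST on `SU(N)` (the inhabitant is the labelled
placeholder of `T4FiniteEpsInhabited`, at which the pinned end statement (B) is FALSE: inhabitation of the TYPE, not of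
Bałaban's densities). [folklore] -/
theorem exists_isBlockAveraged_expMeanLogSU_of_tangentLaw (hT : EMLTangentLaw N) :
    ∃ D : FiniteEpsData F (Matrix.specialUnitaryGroup (Fin N) ℂ), D.IsBlockAveraged expMeanLogSU :=
  T4ApexTwoLevel.exists_isBlockAveraged_expMeanLogSU_of_fibreLaw F (emlFibreLaw_of_tangentLaw hT)

/-- The two-level analogue: GIVEN the tangent law, (0.11)–(0.12)-data with the printed outer average and any measurable inner
average `𝓜` EXIST on `SU(N)` (placeholder inhabitant, as above). [folklore] -/
theorem exists_isBlockAveraged₂_expMeanLogSU_of_tangentLaw (𝓜 : GroupAverage (Matrix.specialUnitaryGroup (Fin N) ℂ))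
    (hM : 𝓜.MeasurableM) (hT : EMLTangentLaw N) :
    ∃ D : FiniteEpsData F (Matrix.specialUnitaryGroup (Fin N) ℂ), D.IsBlockAveraged₂ 𝓜 expMeanLogSU :=
  T4ApexTwoLevel.exists_isBlockAveraged₂_expMeanLogSU_of_fibreLaw F 𝓜 hM (emlFibreLaw_of_tangentLaw hT)

end Consumers

/-! ## 4. (v1.1) DISCHARGED: the tangent law, the fibre law and every consumer, unconditionally on `SU(N)`, every `N ≥ 1` -/

section Discharged

variable [NeZero N]

/-- **`EMLTangentLaw N` HOLDS, EVERY `N ≥ 1`**: the term is `T4EMLTangentInjective.emlTangentLaw_specialUnitary` (explicit strict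
derivative `emlD` of the ambient exp-mean-log map on the guard, injective on all skew tangent vectors `W X` for unitary data in the
guard `< 1/2` with weights `c_i ≥ 0`, `Σ c_i < 1`; the trace-zero clause of the contract is not even used). [folklore] -/
theorem emlTangentLaw_fin : EMLTangentLaw N := fun h c hc0 hc1 W hg =>
  T4EMLTangentInjective.emlTangentLaw_specialUnitary h c hc0 hc1 W hg

/-- **THE EXP-MEAN-LOG FIBRE LAW ON `SU(N)`, EVERY `N ≥ 1`** (`emlFibreLaw_of_tangentLaw emlTangentLaw_fin`): every guarded
exp-mean-log one-variable law `((Haar)|_S).map K` on `SU(N)` is absolutely continuous. [folklore] -/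
theorem emlFibreLaw_fin : EMLFibreLaw (Fin N) := emlFibreLaw_of_tangentLaw emlTangentLaw_fin

/-- Consistency at `N = 2`: a second, non-quaternionic proof of the tree's `emlFibreLaw_fin_two` (same statement). [folklore] -/
example : EMLFibreLaw (Fin 2) := emlFibreLaw_fin

/-- **`HaarAC` FOR (0.4) WITH THE PRINTED AVERAGE ON `SU(N)`, EVERY `N ≥ 1`**, on every torus in the standing range `j + 1 ≤ m + K`
(`BlockAveragingEMLHaarACSUN.haarAC_avgFun_expMeanLogSU_of_fibreLaw` at `emlFibreLaw_fin`). [folklore] -/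
theorem haarAC_avgFun_expMeanLogSU_SUN {P : Params} {j : ℕ} (hj : j + 1 ≤ P.m + P.K) :
    @T4FiniteEpsInhabited.HaarAC P j (Matrix.specialUnitaryGroup (Fin N) ℂ) _ _ _ (avgFun expMeanLogSU) :=
  haarAC_avgFun_expMeanLogSU_of_fibreLaw emlFibreLaw_fin hj

/-- **`HaarAC` FOR (0.12) WITH THE PRINTED OUTER AVERAGE ON `SU(N)`, EVERY `N ≥ 1` AND EVERY INNER AVERAGE `𝓜` WITH MEASURABLE
`M`**, on every torus in the standing range (`BlockAveragingEMLHaarACSUN.haarAC_avgFun₂_expMeanLogSU_of_fibreLaw` at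
`emlFibreLaw_fin`). [folklore] -/
theorem haarAC_avgFun₂_expMeanLogSU_SUN {P : Params} {j : ℕ} (𝓜 : GroupAverage (Matrix.specialUnitaryGroup (Fin N) ℂ))
    (hj : j + 1 ≤ P.m + P.K) (hM : ∀ m, Measurable (fun W : Fin (m+1) → Matrix.specialUnitaryGroup (Fin N) ℂ => 𝓜.M W)) :
    @T4FiniteEpsInhabited.HaarAC P j (Matrix.specialUnitaryGroup (Fin N) ℂ) _ _ _ (avgFun₂ 𝓜 expMeanLogSU) :=
  haarAC_avgFun₂_expMeanLogSU_of_fibreLaw 𝓜 emlFibreLaw_fin hj hM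

variable (F : T4Family)

/-- **THE ONE-LEVEL PRINTED-AVERAGE RESIDUAL OF `T4ApexTwoLevel` DISCHARGED ON `SU(N)`, EVERY `N ≥ 1`**: Bałaban's block
averaging (0.4) driven by the printed small-loop average satisfies `HaarAC` on every torus of the family at every level
(`blockHaarAC_expMeanLogSU_of_tangentLaw F emlTangentLaw_fin`; at `N = 2` cf. `T4ApexTwoLevel.blockHaarAC_expMeanLogSU_SU2`).
[folklore] -/
theorem blockHaarAC_expMeanLogSU_SUN :
    BlockHaarAC F (expMeanLogSU : LoopAverage (Matrix.specialUnitaryGroup (Fin N) ℂ)) :=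
  blockHaarAC_expMeanLogSU_of_tangentLaw F emlTangentLaw_fin

/-- **THE TWO-LEVEL PRINTED-AVERAGE RESIDUAL OF `T4ApexTwoLevel` DISCHARGED ON `SU(N)`, EVERY `N ≥ 1`, FOR EVERY MEASURABLE INNER
AVERAGE `𝓜`** (`blockHaarAC₂_expMeanLogSU_of_tangentLaw F 𝓜 hM emlTangentLaw_fin`; at `N = 2` cf.
`T4ApexTwoLevel.blockHaarAC₂_expMeanLogSU_SU2`). [folklore] -/
theorem blockHaarAC₂_expMeanLogSU_SUN (𝓜 : GroupAverage (Matrix.specialUnitaryGroup (Fin N) ℂ)) (hM : 𝓜.MeasurableM) :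
    BlockHaarAC₂ F 𝓜 (expMeanLogSU : LoopAverage (Matrix.specialUnitaryGroup (Fin N) ℂ)) :=
  blockHaarAC₂_expMeanLogSU_of_tangentLaw F 𝓜 hM emlTangentLaw_fin

/-- Hence (0.4)-data driven by the printed average EXIST on `SU(N)`, every `N ≥ 1` (the inhabitant is the labelled placeholder of
`T4FiniteEpsInhabited`: inhabitation of the TYPE, not of Bałaban's densities). [folklore] -/
theorem exists_isBlockAveraged_expMeanLogSU_SUN :
    ∃ D : FiniteEpsData F (Matrix.specialUnitaryGroup (Fin N) ℂ), D.IsBlockAveraged expMeanLogSU :=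
  exists_isBlockAveraged_expMeanLogSU_of_tangentLaw F emlTangentLaw_fin

/-- … and (0.11)–(0.12)-data with the printed outer average and any measurable inner average `𝓜` EXIST on `SU(N)`, every `N ≥ 1`
(placeholder inhabitant, as above). [folklore] -/
theorem exists_isBlockAveraged₂_expMeanLogSU_SUN (𝓜 : GroupAverage (Matrix.specialUnitaryGroup (Fin N) ℂ))
    (hM : 𝓜.MeasurableM) :
    ∃ D : FiniteEpsData F (Matrix.specialUnitaryGroup (Fin N) ℂ), D.IsBlockAveraged₂ 𝓜 expMeanLogSU :=
  exists_isBlockAveraged₂_expMeanLogSU_of_tangentLaw F 𝓜 hM emlTangentLaw_fin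

/-- The (0.4)-data so obtained satisfy the reflection-positivity and torus-covariance targets in both forms, every `N ≥ 1`
(`BlockAveragingEMLHaarACSUN.exists_blockAvgEML_rp_and_cov_of_fibreLaw` at `emlFibreLaw_fin`; the discharge theorems it rests on
carry the citations). [folklore] -/
theorem exists_blockAvgEML_rp_and_cov_SUN :
    ∃ D : FiniteEpsData F (Matrix.specialUnitaryGroup (Fin N) ℂ), D.IsBlockAveraged expMeanLogSU ∧
      (D.limit_reflectionPositive' ∧ D.limit_reflectionPositive) ∧ (D.limit_torusCovariant' ∧ D.limit_torusCovariant) :=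
  exists_blockAvgEML_rp_and_cov_of_fibreLaw emlFibreLaw_fin F

/-- The two-level analogue: (0.12)-data (any inner `𝓜` with measurable `M`, printed outer average) on `SU(N)` exist and satisfy the
reflection-positivity and torus-covariance targets in both forms, every `N ≥ 1`
(`BlockAveragingEMLHaarACSUN.exists_blockAvg₂_expMeanLogSU_rp_and_cov_of_fibreLaw` at `emlFibreLaw_fin`). [folklore] -/
theorem exists_blockAvg₂_expMeanLogSU_rp_and_cov_SUN (𝓜 : GroupAverage (Matrix.specialUnitaryGroup (Fin N) ℂ))
    (hM : ∀ m, Measurable (fun W : Fin (m+1) → Matrix.specialUnitaryGroup (Fin N) ℂ => 𝓜.M W)) :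
    ∃ D : FiniteEpsData F (Matrix.specialUnitaryGroup (Fin N) ℂ), (∀ K j, D.av K j = blockAvg₂ 𝓜 expMeanLogSU) ∧
      (D.limit_reflectionPositive' ∧ D.limit_reflectionPositive) ∧ (D.limit_torusCovariant' ∧ D.limit_torusCovariant) :=
  exists_blockAvg₂_expMeanLogSU_rp_and_cov_of_fibreLaw 𝓜 emlFibreLaw_fin hM F

/-- HONEST SCOPE, every `N ≥ 1`: at the placeholder inhabitant behind `exists_isBlockAveraged_expMeanLogSU_SUN` the pinned end
statement (B) FAILS (`BlockAveragingEMLHaarACSUN.not_endStatementBPrinted_blockAvgEML_stub_of_fibreLaw` at `emlFibreLaw_fin`) —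
what §4 discharges is the carrier residual `HaarAC`, not an estimate. [folklore] -/
theorem not_endStatementBPrinted_blockAvgEML_stub_SUN :
    ¬ B16.EndStatementBPrinted
      (T4FiniteEpsInhabited.stubData F (Matrix.specialUnitaryGroup (Fin N) ℂ) (fun _ _ => blockAvg expMeanLogSU)
        (fun _ _ => measurable_avgFun expMeanLogSU measurable_expMeanLogSU_E)
        (fun K k hk => haarAC_avgFun_expMeanLogSU_family_of_fibreLaw emlFibreLaw_fin F K k hk)).C :=
  not_endStatementBPrinted_blockAvgEML_stub_of_fibreLaw emlFibreLaw_fin F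

end Discharged

/-! ## 5. (v1.2) The printed two-level operation on `SU(N)`, every `N ≥ 1`: Federbush's inner mean (0.10), exp-mean-log outer average -/

section Federbush

open FederbushMean (federbushSU federbushSU_measurable)

variable [NeZero N]

/-- Federbush's inner mean satisfies the apex hypothesis `GroupAverage.MeasurableM` (whose body `federbushSU_measurable` is,
verbatim). [folklore] -/
theorem measurableM_federbushSU : (federbushSU (n := Fin N)).MeasurableM := federbushSU_measurable

/-- Per torus: the two-level averaging function (0.12) with inner mean (0.10) and outer exp-mean-log satisfies `HaarAC` on `SU(N)`,
every `N ≥ 1` (`haarAC_avgFun₂_expMeanLogSU_SUN` at `federbushSU`). [folklore] -/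
theorem haarAC_avgFun₂_federbushSU_expMeanLogSU {P : Params} {j : ℕ} (hj : j + 1 ≤ P.m + P.K) :
    @T4FiniteEpsInhabited.HaarAC P j (Matrix.specialUnitaryGroup (Fin N) ℂ) _ _ _ (avgFun₂ federbushSU expMeanLogSU) :=
  haarAC_avgFun₂_expMeanLogSU_SUN federbushSU hj federbushSU_measurable

variable (F : T4Family)

/-- **THE TWO-LEVEL PRINTED-AVERAGE RESIDUAL WITH THE PRINTED INNER MEAN, `SU(N)`, EVERY `N ≥ 1`**: block averaging (0.11)–(0.12)
with Federbush's mean (0.10) inside and the exp-mean-log average outside satisfies `HaarAC` on every torus of the family at every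
level (`blockHaarAC₂_expMeanLogSU_SUN F federbushSU measurableM_federbushSU`; at `N = 2` with the quaternionic inner mean cf.
`T4ApexTwoLevel.blockHaarAC₂_su2GroupMean_expMeanLogSU`). [folklore] -/
theorem blockHaarAC₂_federbushSU_expMeanLogSU :
    BlockHaarAC₂ F (federbushSU (n := Fin N)) (expMeanLogSU : LoopAverage (Matrix.specialUnitaryGroup (Fin N) ℂ)) :=
  blockHaarAC₂_expMeanLogSU_SUN F federbushSU federbushSU_measurable

/-- Hence (0.11)–(0.12)-data with BOTH printed operations EXIST on `SU(N)`, every `N ≥ 1` (placeholder inhabitant of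
`T4FiniteEpsInhabited`: inhabitation of the TYPE, not of Bałaban's densities). [folklore] -/
theorem exists_isBlockAveraged₂_federbushSU_expMeanLogSU :
    ∃ D : FiniteEpsData F (Matrix.specialUnitaryGroup (Fin N) ℂ), D.IsBlockAveraged₂ federbushSU expMeanLogSU :=
  exists_isBlockAveraged₂_expMeanLogSU_SUN F federbushSU federbushSU_measurable

/-- … and such data satisfy the reflection-positivity and torus-covariance targets in both forms, every `N ≥ 1`
(`exists_blockAvg₂_expMeanLogSU_rp_and_cov_SUN` at `federbushSU`). [folklore] -/
theorem exists_blockAvg₂_federbushSU_expMeanLogSU_rp_and_cov :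
    ∃ D : FiniteEpsData F (Matrix.specialUnitaryGroup (Fin N) ℂ), (∀ K j, D.av K j = blockAvg₂ federbushSU expMeanLogSU) ∧
      (D.limit_reflectionPositive' ∧ D.limit_reflectionPositive) ∧ (D.limit_torusCovariant' ∧ D.limit_torusCovariant) :=
  exists_blockAvg₂_expMeanLogSU_rp_and_cov_SUN F federbushSU federbushSU_measurable

end Federbush

end BlockAveragingEMLFibreLawSUN

end Literature.MathematicalPhysics.QuantumFieldTheory.Balaban1983to89
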